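import Mathlib
import Literature.Analysis.FluidPDE.VectorCalculus
import Summits.NavierStokesRegularity.NavierStokesRegularity.Theorems.FilamentSkeletonRssSkeletonEquilibriumSymmetryRigidity

/-!
# ℤ₂-symmetry TRANSPORT of the regularised Biot–Savart induction for a GENERAL (matched / rigid) CORE:
# `u(Mx + c)ᵢ = κ sᵢ u(x)ᵢ` for the kernel `((‖x − Ξ_k σ‖² + A_k σ)^{3/2})⁻¹` with symmetric cores `A_{πk}(εσ) = A_k σ`

Port of `Theorems.SkeletonEquilibrium.SymmetryRigidity.{deriv,integrand,integral,induction}_apply_symm` (p831xxx, `+1` kernel, support item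
`SkeletonEquilibrium` 15400) to the CORE-CARRYING kernel of the live cruxes — `TangentSkeletonNearStraightL` (stmt-NavierStokesRegularity-23320; rigid
UNIT cores `A ≡ e^{−(1+γ_E−log 2)}` after `Theorems.TangentSkeletonLCurveCore`, p837172), its parent `SkeletonJ1L` (23296) and the A1G twins
(matched cores `e^{−(1+γ_E−log 2)}·Aa_k σ`).  SYMMETRY DATA (def-free, coordinates, as in the source file): a diagonal orthogonal map `M = diag(s₀,s₁,s₂)`,
`sᵢ = ±1`, a translation `c`, a parameter sign `ε = ±1`, an involutive relabelling `π` with `Ξ_{πk}(εσ)ᵢ = sᵢ Ξ_k(σ)ᵢ + cᵢ` (`hsym`) AND — the one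
new hypothesis — cores transported along: `A_{πk}(εσ) = A_k(σ)` (`hA`; automatic for constant cores).  With `κ := ε s₀s₁s₂`:
* velocities by the landed `SkeletonEquilibrium.SymmetryRigidity.deriv_apply_symm` (`Ξ_{πk}′(εσ)ᵢ = ε sᵢ Ξ_k′(σ)ᵢ`, imported);
* `integrand_apply_symm` — the cored integrand of filament `πk` at `(Mx + c, εσ)` is `κ sᵢ` times that of filament `k` at `(x, σ)`;
* `integral_apply_symm`, ★ `induction_apply_symm` — `u(Mx + c)ᵢ = κ sᵢ u(x)ᵢ` for the total cored induction `Σ_k (Γγ_k/4π) ∫ …` (`γ ∘ π = γ`,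
  integrability clause at every `(k, x)`).
USE (the case that matters for ⟨23296⟩/⟨23320⟩): the landed general-position datum `straightDatumGP_exists` is an `R_π`-SYMMETRIC PAIR — `M = diag(−1,−1,1)`,
`c = 0`, `ε = 1`, `π = swap`, `κ = 1` (the COMPATIBLE class: `R_π` commutes with the frame `½y − α e₃×y`) — so a skeleton built in the symmetric class
`X₁ = R_π ∘ X₀`, `Aa₁ = Aa₀` has `v(R_π y) = R_π v(y)` (`frame_apply_halfTurn` below + this transport), and every clause of filament `1` is the
transported clause of filament `0` (strategist S⁺8 «symmetry-class construction», `Cruxes/SkeletonJ1L/STRATEGY-CENSUS.md` PART III).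
HONEST FRAMING: vector calculus for a HYPOTHETICAL filament skeleton on the NEGATIVE side of a MODEL route; no registered stub or crux is proved; nothing
here bears on Navier–Stokes regularity or blow-up.  Mathlib + `Literature.Analysis.FluidPDE.VectorCalculus` (`cross`) + the source file only; no route file imported.
`--supports stmt-NavierStokesRegularity-23320`. [folklore]
-/

set_option linter.dupNamespace false

noncomputable section

-- `NavierStokesRegularity.NavierStokesRegularity` is the summit/problem path (D-0017), flagged by dupNamespace.
namespace Summit.NavierStokesRegularity.NavierStokesRegularity.Theorems.MatchedKernelSymmetryTransport

open Literature.Analysis.FluidPDE MeasureTheory Filter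
open scoped RealInnerProductSpace InnerProductSpace BigOperators Topology

/-- Components of the cross product `v × w`. [folklore] -/
private theorem mkst_cross_apply_fin3 (v w : EuclideanSpace ℝ (Fin 3)) :
    cross v w 0 = v 1 * w 2 - v 2 * w 1 ∧ cross v w 1 = v 2 * w 0 - v 0 * w 2 ∧
      cross v w 2 = v 0 * w 1 - v 1 * w 0 := by
  refine ⟨?_, ?_, ?_⟩ <;> simp [cross, cross_apply]

/-- `⟪eᵢ, v⟫ = v i`. [folklore] -/
private theorem mkst_inner_single_left (i : Fin 3) (v : EuclideanSpace ℝ (Fin 3)) :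
    ⟪EuclideanSpace.single i (1 : ℝ), v⟫ = v i := by
  rw [EuclideanSpace.inner_single_left]; simp

/-- A component of a Bochner integral of an integrable `ℝ³`-valued function is the integral of the component. [folklore] -/
private theorem mkst_integral_apply_eq {F : ℝ → EuclideanSpace ℝ (Fin 3)} (hF : Integrable F) (i : Fin 3) :
    (∫ σ, F σ) i = ∫ σ, F σ i := by
  rw [← mkst_inner_single_left i, ← integral_inner hF]
  exact integral_congr_ae (Eventually.of_forall fun σ => mkst_inner_single_left i (F σ))

/-- `‖v‖²` in coordinates. [folklore] -/
private theorem mkst_norm_sq_fin3 (v : EuclideanSpace ℝ (Fin 3)) : ‖v‖ ^ 2 = v 0 ^ 2 + v 1 ^ 2 + v 2 ^ 2 := by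
  rw [EuclideanSpace.norm_sq_eq]
  simp [Fin.sum_univ_three, Real.norm_eq_abs, sq_abs]

section Symm

variable {N : ℕ} {Ξ : Fin N → ℝ → EuclideanSpace ℝ (Fin 3)} {A : Fin N → ℝ → ℝ} {π : Fin N → Fin N} {s c : Fin 3 → ℝ} {ε : ℝ}
  (hd : ∀ k, Differentiable ℝ (Ξ k)) (hs : ∀ i, s i * s i = 1) (hε : ε * ε = 1)
  (hsym : ∀ k σ i, Ξ (π k) (ε * σ) i = s i * Ξ k σ i + c i) (hA : ∀ k σ, A (π k) (ε * σ) = A k σ)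
include hd hs hε hsym

include hA in
/-- Integrand transport at an arbitrary field point, CORED kernel: for `x′ = Mx + c`, the `i`-th component of the induction integrand of filament
`πk` at parameter `εσ` (core `A_{πk}(εσ) = A_k σ`) equals `ε s₀s₁s₂ · sᵢ` times that of filament `k` at `σ`. [folklore] -/
theorem integrand_apply_symm (k : Fin N) (x x' : EuclideanSpace ℝ (Fin 3)) (hx' : ∀ i, x' i = s i * x i + c i)
    (σ : ℝ) (i : Fin 3) :
    (((‖x' - Ξ (π k) (ε * σ)‖ ^ 2 + A (π k) (ε * σ)) ^ (3 / 2 : ℝ))⁻¹ •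
        cross (deriv (Ξ (π k)) (ε * σ)) (x' - Ξ (π k) (ε * σ))) i =
      ε * (s 0 * s 1 * s 2) * s i *
        (((‖x - Ξ k σ‖ ^ 2 + A k σ) ^ (3 / 2 : ℝ))⁻¹ • cross (deriv (Ξ k) σ) (x - Ξ k σ)) i := by
  have hR : ∀ j, (x' - Ξ (π k) (ε * σ)) j = s j * (x - Ξ k σ) j := by
    intro j; rw [PiLp.sub_apply, PiLp.sub_apply, hx' j, hsym k σ j]; ring
  have hT : ∀ j, deriv (Ξ (π k)) (ε * σ) j = ε * s j * deriv (Ξ k) σ j :=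
    fun j => SkeletonEquilibrium.SymmetryRigidity.deriv_apply_symm hd hε hsym k σ j
  have hnorm : ‖x' - Ξ (π k) (ε * σ)‖ = ‖x - Ξ k σ‖ := by
    have h2 : ‖x' - Ξ (π k) (ε * σ)‖ ^ 2 = ‖x - Ξ k σ‖ ^ 2 := by
      rw [mkst_norm_sq_fin3, mkst_norm_sq_fin3, hR 0, hR 1, hR 2]
      linear_combination ((x - Ξ k σ) 0) ^ 2 * hs 0 + ((x - Ξ k σ) 1) ^ 2 * hs 1 +
        ((x - Ξ k σ) 2) ^ 2 * hs 2
    nlinarith [norm_nonneg (x' - Ξ (π k) (ε * σ)), norm_nonneg (x - Ξ k σ)]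
  have hAk : A (π k) (ε * σ) = A k σ := hA k σ
  obtain ⟨c0, c1, c2⟩ := mkst_cross_apply_fin3 (deriv (Ξ (π k)) (ε * σ)) (x' - Ξ (π k) (ε * σ))
  obtain ⟨d0, d1, d2⟩ := mkst_cross_apply_fin3 (deriv (Ξ k) σ) (x - Ξ k σ)
  fin_cases i
  · simp only [PiLp.smul_apply, smul_eq_mul, hnorm, hAk, Fin.zero_eta, c0, d0, hR, hT]
    linear_combination (ε * s 1 * s 2 * ((‖x - Ξ k σ‖ ^ 2 + A k σ) ^ (3 / 2 : ℝ))⁻¹ *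
      (deriv (Ξ k) σ 1 * (x - Ξ k σ) 2 - deriv (Ξ k) σ 2 * (x - Ξ k σ) 1)) * (-(hs 0))
  · simp only [PiLp.smul_apply, smul_eq_mul, hnorm, hAk, Fin.mk_one, c1, d1, hR, hT]
    linear_combination (ε * s 2 * s 0 * ((‖x - Ξ k σ‖ ^ 2 + A k σ) ^ (3 / 2 : ℝ))⁻¹ *
      (deriv (Ξ k) σ 2 * (x - Ξ k σ) 0 - deriv (Ξ k) σ 0 * (x - Ξ k σ) 2)) * (-(hs 1))
  · simp only [PiLp.smul_apply, smul_eq_mul, hnorm, hAk, Fin.reduceFinMk, c2, d2, hR, hT]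
    linear_combination (ε * s 0 * s 1 * ((‖x - Ξ k σ‖ ^ 2 + A k σ) ^ (3 / 2 : ℝ))⁻¹ *
      (deriv (Ξ k) σ 0 * (x - Ξ k σ) 1 - deriv (Ξ k) σ 1 * (x - Ξ k σ) 0)) * (-(hs 2))

include hA in
/-- ★ **Transport of one filament's CORED induction**: `u_{πk}(Mx + c)ᵢ = ε s₀s₁s₂ · sᵢ · u_k(x)ᵢ`, given the integrability clause at `(k, x)` and
`(πk, Mx + c)` (substitution `σ ↦ εσ`, `|ε| = 1`). [folklore] -/
theorem integral_apply_symm (k : Fin N) (x x' : EuclideanSpace ℝ (Fin 3)) (hx' : ∀ i, x' i = s i * x i + c i)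
    (hI : Integrable (fun σ : ℝ => ((‖x - Ξ k σ‖ ^ 2 + A k σ) ^ (3 / 2 : ℝ))⁻¹ •
      cross (deriv (Ξ k) σ) (x - Ξ k σ)))
    (hI' : Integrable (fun σ : ℝ => ((‖x' - Ξ (π k) σ‖ ^ 2 + A (π k) σ) ^ (3 / 2 : ℝ))⁻¹ •
      cross (deriv (Ξ (π k)) σ) (x' - Ξ (π k) σ))) (i : Fin 3) :
    (∫ σ : ℝ, ((‖x' - Ξ (π k) σ‖ ^ 2 + A (π k) σ) ^ (3 / 2 : ℝ))⁻¹ •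
        cross (deriv (Ξ (π k)) σ) (x' - Ξ (π k) σ)) i =
      ε * (s 0 * s 1 * s 2) * s i *
        (∫ σ : ℝ, ((‖x - Ξ k σ‖ ^ 2 + A k σ) ^ (3 / 2 : ℝ))⁻¹ • cross (deriv (Ξ k) σ) (x - Ξ k σ)) i := by
  have habs : |ε⁻¹| = 1 := by
    have h1 : |ε| = 1 := by
      have : |ε| * |ε| = 1 := by rw [← abs_mul, hε, abs_one]
      nlinarith [abs_nonneg ε]
    rw [abs_inv, h1, inv_one]
  have hsub : ∫ σ : ℝ, (((‖x' - Ξ (π k) (ε * σ)‖ ^ 2 + A (π k) (ε * σ)) ^ (3 / 2 : ℝ))⁻¹ •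
      cross (deriv (Ξ (π k)) (ε * σ)) (x' - Ξ (π k) (ε * σ))) i =
      ∫ σ : ℝ, (((‖x' - Ξ (π k) σ‖ ^ 2 + A (π k) σ) ^ (3 / 2 : ℝ))⁻¹ •
        cross (deriv (Ξ (π k)) σ) (x' - Ξ (π k) σ)) i := by
    rw [Measure.integral_comp_mul_left (fun σ => (((‖x' - Ξ (π k) σ‖ ^ 2 + A (π k) σ) ^ (3 / 2 : ℝ))⁻¹ •
      cross (deriv (Ξ (π k)) σ) (x' - Ξ (π k) σ)) i) ε, habs, one_smul]
  rw [mkst_integral_apply_eq hI' i, mkst_integral_apply_eq hI i, ← hsub, ← integral_const_mul]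
  exact integral_congr_ae (Eventually.of_forall fun σ => integrand_apply_symm hd hs hε hsym hA k x x' hx' σ i)

include hA in
/-- ★ **Transport of the total CORED induction**: with `π` an involution and `γ_{πk} = γ_k`, `u(Mx + c)ᵢ = κ sᵢ u(x)ᵢ`, `κ = ε s₀s₁s₂`, given the
integrability clause at every `(k, x)`. [folklore] -/
theorem induction_apply_symm (hπ : ∀ k, π (π k) = k) (γ : Fin N → ℝ) (hγ : ∀ k, γ (π k) = γ k) (C : ℝ)
    (hint : ∀ k (x : EuclideanSpace ℝ (Fin 3)), Integrable (fun σ : ℝ =>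
      ((‖x - Ξ k σ‖ ^ 2 + A k σ) ^ (3 / 2 : ℝ))⁻¹ • cross (deriv (Ξ k) σ) (x - Ξ k σ)))
    (x x' : EuclideanSpace ℝ (Fin 3)) (hx' : ∀ i, x' i = s i * x i + c i) (i : Fin 3) :
    (∑ k : Fin N, (C * γ k / (4 * Real.pi)) • ∫ σ : ℝ, ((‖x' - Ξ k σ‖ ^ 2 + A k σ) ^ (3 / 2 : ℝ))⁻¹ •
        cross (deriv (Ξ k) σ) (x' - Ξ k σ)) i =
      ε * (s 0 * s 1 * s 2) * s i *
        (∑ k : Fin N, (C * γ k / (4 * Real.pi)) • ∫ σ : ℝ, ((‖x - Ξ k σ‖ ^ 2 + A k σ) ^ (3 / 2 : ℝ))⁻¹ •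
          cross (deriv (Ξ k) σ) (x - Ξ k σ)) i := by
  set I : Fin N → EuclideanSpace ℝ (Fin 3) := fun k => ∫ σ : ℝ, ((‖x - Ξ k σ‖ ^ 2 + A k σ) ^ (3 / 2 : ℝ))⁻¹ •
    cross (deriv (Ξ k) σ) (x - Ξ k σ) with hI
  set I' : Fin N → EuclideanSpace ℝ (Fin 3) := fun k => ∫ σ : ℝ, ((‖x' - Ξ k σ‖ ^ 2 + A k σ) ^ (3 / 2 : ℝ))⁻¹ •
    cross (deriv (Ξ k) σ) (x' - Ξ k σ) with hI'
  have hpart : ∀ k, I' (π k) i = ε * (s 0 * s 1 * s 2) * s i * I k i := fun k =>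
    integral_apply_symm hd hs hε hsym hA k x x' hx' (hint k x) (hint (π k) x') i
  have hbij : Function.Bijective π := Function.Involutive.bijective hπ
  have hcomp : ∀ (J : Fin N → EuclideanSpace ℝ (Fin 3)),
      (∑ k : Fin N, (C * γ k / (4 * Real.pi)) • J k) i = ∑ k : Fin N, C * γ k / (4 * Real.pi) * J k i := by
    intro J
    rw [← mkst_inner_single_left i]
    simp_rw [inner_sum, real_inner_smul_right, mkst_inner_single_left]
  have hre : ∑ k : Fin N, C * γ k / (4 * Real.pi) * I' k i =
      ∑ k : Fin N, C * γ (π k) / (4 * Real.pi) * I' (π k) i :=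
    (Fintype.sum_bijective π hbij (fun k => C * γ (π k) / (4 * Real.pi) * I' (π k) i)
      (fun k => C * γ k / (4 * Real.pi) * I' k i) (fun k => rfl)).symm
  change (∑ k : Fin N, (C * γ k / (4 * Real.pi)) • I' k) i =
    ε * (s 0 * s 1 * s 2) * s i * (∑ k : Fin N, (C * γ k / (4 * Real.pi)) • I k) i
  rw [hcomp I', hcomp I, hre, Finset.mul_sum]
  refine Finset.sum_congr rfl fun k _ => ?_
  rw [hγ k, hpart k]; ring

end Symm

/-- **The frame commutes with the half-turn about `e₃`.**  For `R_π = diag(−1,−1,1)` (in coordinates: `x′₀ = −x₀`, `x′₁ = −x₁`, `x′₂ = x₂`) the Leray–rotating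
frame field `F y = ½ y − α e₃ × y` satisfies `F(R_π y)ᵢ = sᵢ F(y)ᵢ`, `s = (−1,−1,1)` — the COMPATIBLE class `κ = 1`, `s₀s₁ = 1`. [folklore] -/
theorem frame_apply_halfTurn (α : ℝ) (y y' : EuclideanSpace ℝ (Fin 3)) (hy : y' 0 = -y 0 ∧ y' 1 = -y 1 ∧ y' 2 = y 2) :
    ((1/2 : ℝ) • y' - α • cross (EuclideanSpace.single 2 1) y') 0 = -(((1/2 : ℝ) • y - α • cross (EuclideanSpace.single 2 1) y) 0) ∧
    ((1/2 : ℝ) • y' - α • cross (EuclideanSpace.single 2 1) y') 1 = -(((1/2 : ℝ) • y - α • cross (EuclideanSpace.single 2 1) y) 1) ∧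
    ((1/2 : ℝ) • y' - α • cross (EuclideanSpace.single 2 1) y') 2 = ((1/2 : ℝ) • y - α • cross (EuclideanSpace.single 2 1) y) 2 := by
  obtain ⟨h0, h1, h2⟩ := hy
  obtain ⟨c0, c1, c2⟩ := mkst_cross_apply_fin3 (EuclideanSpace.single (2 : Fin 3) (1 : ℝ)) y
  obtain ⟨c0', c1', c2'⟩ := mkst_cross_apply_fin3 (EuclideanSpace.single (2 : Fin 3) (1 : ℝ)) y'
  simp only [PiLp.sub_apply, PiLp.smul_apply, smul_eq_mul, c0, c1, c2, c0', c1', c2', h0, h1, h2]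
  refine ⟨?_, ?_, ?_⟩ <;> simp <;> ring

end Summit.NavierStokesRegularity.NavierStokesRegularity.Theorems.MatchedKernelSymmetryTransport

end
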